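import Literature.MathematicalPhysics.QuantumFieldTheory.Balaban1983to89.B9Eq315QLipschitz
import Literature.MathematicalPhysics.QuantumFieldTheory.Balaban1983to89.B9Eq319QprimeLipschitz
import Literature.MathematicalPhysics.QuantumFieldTheory.Balaban1983to89.B9Eq315QTowerFlat
import Literature.MathematicalPhysics.QuantumFieldTheory.Balaban1983to89.B9Eq384RemainderLetters

/-!
# `Balaban1983to89.B9Eq315QTowerLipschitz` — T. Bałaban, *Propagators for lattice gauge theories in a background field*, Commun. Math. Phys.
# **99** (1985) 389–434 [Balaban1985BackgroundPropagators] (3.15)/(3.19) p. 393 with (3.78)–(3.81) p. 406: THE COMPOSITE AVERAGINGS `Q_k(U)`,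
# `Q′_k(U)` OF THE TOWER ARE LIPSCHITZ IN THE BACKGROUND AT THE FLAT ONE — the TOWER averaging letters `ρ′_k`, `δ_{Q,k}` displayed by
# `B9Thm311SmallFieldCoercivityTower` PRODUCED from the one-step moduli of NE9 leaf-03 (`B9Eq319QprimeLipschitz`, print's `F′₂`) and NE9
# leaf-04 (`B9Eq315QLipschitz`, print's `F₂`) by telescoping over the levels, modulo the DISPLAYED smallness of the averaged backgrounds `Ū^j`

statement-level skeleton of published theorems with citation tags; proofs where landed; nothing here is a claim about the Yang–Mills mass gap

CITATION HEADER (lean-in-tree rule).  Audit cell `pub-balaban`, sub-cell `t4`, BINDER row NE9; filed by the row OWNER lineage `b2b-balaban-t4-ne9-p1`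
(gen 83).  Sources READ by this lineage in the held texts: [Balaban1985BackgroundPropagators] pp. 393, 403, 406 (`paper:balaban1985-cmp99-background-propagators`,
journal page = PDF page + 388); [Balaban1985Averaging] (124)–(127) pp. 36–37, Prop. 2 (52)–(54) p. 26.

THE PRINT (verbatim).  (3.15) p. 393: *«Q_j(U) = Q(Ū^{j−1})…Q(Ū)Q(U)»*; p. 403: the averaging and projection operators at `U` *«satisfy the same
bounds»* as at `U = 1`; (3.78)–(3.79) p. 406: *«Q(exp(iB)V) = Q(V) + F₂(B)»* with `F₂` small; [Balaban1985Averaging] Prop. 2 (52)–(54) p. 26: the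
averaged configurations `Ū^j` stay regular and small when `U` is.

WHAT IS PROVED (sorry-free; proof lane — no `def`, no `Prop` placeholder, no inequality of the papers asserted hypothesis-free).
* §1 one-step operator bounds in the sup norm: `norm_QprimeLin_id_le` (`‖Q′(1)λ‖_∞ ≤ ‖λ‖_∞`), `norm_QprimeLin_le` (`‖Q′(R)λ‖_∞ ≤ (1+ε)^{d(L−1)}‖λ‖_∞`
  for transporters `ε`-close to the identity), `norm_QtorusLin_apply_le` (`‖(Q(V)A)(c)‖ ≤ (1 + 50(d+1)α)·sup‖A‖` from [Balaban1985Averaging]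
  (126) = `B7Prop3GeneralLinearBound.norm_linQcov_le`, `α` the block-loop regularity of `V`).
* §2 THE TOWER by telescoping (induction on levels): **`norm_QprimeTower_sub_id_le`** (`‖Q′_n(R)λ − Q′_n(1)λ‖_∞ ≤ ((1+ε)^{d(L−1)n} − 1)‖λ‖_∞` for a
  level family of transporters each `ε`-close to the identity), **`norm_Qtower_sub_flat_apply_le`** (`‖(Q_n(V)A)(c) − (Q_n(1)A)(c)‖ ≤ (2^n − 1)·102(d+1)²L·ε̄·sup‖A‖`
  for a level family with bond variables `ε̄`-close to `1` in `U1` and the regime `50(d+1)α_j ≤ 1`).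
* §3 THE READINGS at the letters of `B9Eq326OperatorTower` ∕ `B9Thm311SmallFieldCoercivityTower`: **`norm_QprimeTowerW_sub_flat_le`** (the `ρ′_k`
  display: `‖Q′_k(U)λ − Q′_k(1)λ‖_∞ ≤ ((1 + 2M_φM_φ′ε̄)^{d(L−1)(n+1)} − 1)·(√c₀)⁻¹·‖λ‖_{L²}`) and **`norm_QkW_sub_flat_le`** (the `δ_{Q,k}` display:
  `‖Q_k(U)f − Q_k(1)f‖_{L²} ≤ M_φ′M_φ√(c₁|𝔅(T_m)|∕c₀)·(2^{n+1} − 1)·102(d+1)²L·ε̄·‖f‖_{L²}`), both modulo the DISPLAYED smallness of the level backgrounds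
  `‖Ū^j(b) − 1‖ ≤ ε̄`, `Ū^j(b) ∈ U1` ([Balaban1985Averaging] Prop. 2 — T, not proved here).
HONEST SCOPE.  [folklore] telescoping of landed one-step moduli; crude finite-lattice constants (exponential in the number of levels); the smallness of
the averaged backgrounds is DISPLAYED; NOT print's uniformity; NOT summit progress (cell pub-balaban: NE9 NOT PRINTED ∕ NOT PROVED; spine PROVED 0∕9).
NEW file; nothing modified.  Net new unproved facts: 0.
-/

noncomputable section

open scoped BigOperators

namespace Literature.MathematicalPhysics.QuantumFieldTheory.Balaban1983to89.B9Eq315QTowerLipschitz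

open B4Sect5Torus (TSite)
open B9SectCLatticeCarrier (Bond)
open B7Prop1Explicit (U1 Wcx boxVec)
open B7Prop3GeneralLinearBound (norm_linQcov_le)
open B9Eq311L2Pairing (WL2)
open B11Eq103H1Complex (SiteL2K BondL2K)
open B9Eq319QprimeTorus (fineP QprimeLin)
open B9Eq319QprimeLipschitz (norm_QprimeLin_sub_flat_le QprimeLin_flat_apply blockMean_norm_le rho_nonneg pi_norm_le_WL2_norm)
open B9Eq315QTorus (perSite perCfg perCfg_apply cornerSite QtorusLin QtorusLin_apply)
open B9Eq315QTorusOnto (liftSite perSite_liftSite)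
open B9Eq315QLipschitz (norm_QtorusLin_sub_flat_le norm_apply_le_of_WL2 norm_WL2_le_of_pointwise)
open B9Eq315QTower (towerP UlevOf Qtower Qtower_succ QkOfU QprimeTower QprimeTower_succ)
open B9Eq315QTowerFlat (UlevOf_one perCfg_UlevOf_one_mem_U1 norm_Wcx_UlevOf_one_sub_one_le)
open B9Eq326OperatorTower (QprimeTowerW QkW)
open B9Eq310HessianOperator (adTransportW)
open B5Eq172HodgePositivity (adTransportW_one)
open B9Eq384RemainderLetters (norm_adTransportW_sub_le)

variable {d : ℕ} (L : ℕ) [NeZero L]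

/-! ## §1 One-step operator bounds in the sup norm -/

section OneStep

variable (P : Fin d → ℕ) [∀ i, NeZero (P i)] {V : Type*} [NormedAddCommGroup V] [NormedSpace ℂ V]

omit [∀ i, NeZero (P i)] in
/-- **`‖Q′(1)λ‖_∞ ≤ ‖λ‖_∞`**: the plain block mean does not increase the sup norm (`|B(y)| = L^d` against the weight `L^{−d}`).
[cite: Balaban1985BackgroundPropagators, (3.19) p.393] -/
theorem norm_QprimeLin_id_le (l : TSite d (fineP L P) → V) :
    ‖QprimeLin L P (fun _ : Bond d (fineP L P) => (LinearMap.id : V →ₗ[ℂ] V)) l‖ ≤ ‖l‖ := by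
  refine (pi_norm_le_iff_of_nonneg (norm_nonneg _)).2 fun y => ?_
  rw [QprimeLin_flat_apply]
  refine (norm_sum_le _ _).trans ?_
  have h : ∑ x ∈ B9Eq319QprimeTorus.blockOf L P y, ‖(((L : ℝ) ^ d)⁻¹) • l x‖ =
      ((L : ℝ) ^ d)⁻¹ * ∑ x ∈ B9Eq319QprimeTorus.blockOf L P y, ‖l x‖ := by
    rw [Finset.mul_sum]
    refine Finset.sum_congr rfl fun x _ => ?_
    rw [norm_smul, norm_inv, norm_pow, Real.norm_natCast]
  rw [h]
  exact blockMean_norm_le L P l y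

omit [∀ i, NeZero (P i)] in
/-- **`‖Q′(R)λ‖_∞ ≤ (1+ε)^{d(L−1)}·‖λ‖_∞`** for bond transporters `ε`-close to the identity (p. 403 «satisfy the same bounds»): the flat bound plus
NE9 leaf-03's modulus `norm_QprimeLin_sub_flat_le`. [cite: Balaban1985BackgroundPropagators, (3.19) p.393, p.403] -/
theorem norm_QprimeLin_le (Rb : Bond d (fineP L P) → V →ₗ[ℂ] V) {ε : ℝ} (hε : 0 ≤ ε) (hR : ∀ b v, ‖Rb b v - v‖ ≤ ε * ‖v‖)
    (l : TSite d (fineP L P) → V) : ‖QprimeLin L P Rb l‖ ≤ (1 + ε) ^ (d * (L - 1)) * ‖l‖ := by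
  have h1 := norm_QprimeLin_sub_flat_le L P Rb hε hR l
  have h2 := norm_QprimeLin_id_le L P l
  have h3 := norm_add_le (QprimeLin L P Rb l - QprimeLin L P (fun _ => LinearMap.id) l) (QprimeLin L P (fun _ => LinearMap.id) l)
  rw [sub_add_cancel] at h3
  nlinarith [norm_nonneg l]

variable {𝔸 : Type*} [NormedRing 𝔸] [NormedAlgebra ℂ 𝔸] [CompleteSpace 𝔸] [NormOneClass 𝔸] (hL : 1 ≤ L)
  (Vb : Bond d (fineP L P) → 𝔸ˣ) {α : ℝ} (hα1 : α ≤ 1 / 64)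
  (hU1 : ∀ (x : B7Prop1Explicit.Site d) (κ : Fin d), perCfg (fineP L P) Vb x κ ∈ U1 𝔸)
  (hreg : ∀ (y : TSite d P) (κ : Fin d) (r : Fin d → Fin L), ‖((Wcx L (perCfg (fineP L P) Vb) (cornerSite L y) κ (boxVec L r) : 𝔸ˣ) : 𝔸) - 1‖ ≤ α)

include hL in
/-- **[Balaban1985Averaging] (126) AT THE TORUS LETTERS: `‖(Q(V)A)(c)‖ ≤ (1 + 50(d+1)α)·sup‖A‖`** (`B7Prop3GeneralLinearBound.norm_linQcov_le` at the
periodic extensions, the `L⁻¹` of `QtorusLin`; `α` = the block-loop regularity displayed by `QtorusLin`). [cite: Balaban1985Averaging, (126) p.36; Balaban1985BackgroundPropagators, (3.15) p.393] -/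
theorem norm_QtorusLin_apply_le (A : Bond d (fineP L P) → 𝔸) {a : ℝ} (ha : 0 ≤ a) (hA : ∀ b, ‖A b‖ ≤ a) (c : Bond d P) :
    ‖QtorusLin L P hL Vb hα1 hU1 hreg A c‖ ≤ (1 + 50 * (d + 1) * α) * a := by
  have hLpos : (0 : ℝ) < L := by exact_mod_cast hL
  have hα0 : 0 ≤ α := (norm_nonneg _).trans (hreg c.1 c.2 fun _ => 0)
  have hα8 : α ≤ 1 / 8 := hα1.trans (by norm_num)
  have hAp : ∀ (x : B7Prop1Explicit.Site d) (κ : Fin d), ‖perCfg (fineP L P) A x κ‖ ≤ a := fun x κ => hA _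
  have h := norm_linQcov_le L hU1 ha hAp hL (cornerSite L c.1) c.2 hα0 hα8 (hreg c.1 c.2)
  rw [QtorusLin_apply, norm_smul, norm_inv, Complex.norm_natCast, inv_mul_le_iff₀ hLpos]
  exact h.trans (le_of_eq (by ring))

include hL in
/-- The one-step averaging's VALUE depends on the background only, not on the displayed regularity data: along `V = V′` the two readings agree
(`QtorusLin_apply` is `L⁻¹ • linQcov …` by `rfl`). [cite: Balaban1985BackgroundPropagators, (3.15) p.393] -/
theorem QtorusLin_apply_eq_of_eq {Vb' : Bond d (fineP L P) → 𝔸ˣ} (hV : Vb = Vb') {α' : ℝ} (hα1' : α' ≤ 1 / 64)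
    (hU1' : ∀ (x : B7Prop1Explicit.Site d) (κ : Fin d), perCfg (fineP L P) Vb' x κ ∈ U1 𝔸)
    (hreg' : ∀ (y : TSite d P) (κ : Fin d) (r : Fin d → Fin L), ‖((Wcx L (perCfg (fineP L P) Vb') (cornerSite L y) κ (boxVec L r) : 𝔸ˣ) : 𝔸) - 1‖ ≤ α')
    (A : Bond d (fineP L P) → 𝔸) : ∀ c, QtorusLin L P hL Vb hα1 hU1 hreg A c = QtorusLin L P hL Vb' hα1' hU1' hreg' A c := by
  subst hV
  intro c
  rw [QtorusLin_apply, QtorusLin_apply]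

end OneStep

/-! ## §2 The tower: telescoping over the levels -/

section TowerPrime

variable (m : Fin d → ℕ) [∀ i, NeZero (m i)] {V : Type*} [NormedAddCommGroup V] [NormedSpace ℂ V]

omit [∀ i, NeZero (m i)] in
/-- **`‖Q′_n(1)λ‖_∞ ≤ ‖λ‖_∞` along the tower** (`n` flat block means). [cite: Balaban1985BackgroundPropagators, (3.19) p.393] -/
theorem norm_QprimeTower_id_le :
    ∀ (n : ℕ) (l : TSite d (towerP L m n) → V), ‖QprimeTower L m (fun _ _ => (LinearMap.id : V →ₗ[ℂ] V)) n l‖ ≤ ‖l‖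
  | 0, _ => le_rfl
  | n + 1, l => by
    show ‖QprimeTower L m (fun _ _ => (LinearMap.id : V →ₗ[ℂ] V)) n
        (QprimeLin L (towerP L m n) (fun _ : Bond d (fineP L (towerP L m n)) => (LinearMap.id : V →ₗ[ℂ] V)) l)‖ ≤ ‖l‖
    exact (norm_QprimeTower_id_le n _).trans (norm_QprimeLin_id_le L (towerP L m n) l)

omit [∀ i, NeZero (m i)] in
/-- **`Q′_n(R)` AGAINST `Q′_n(1)` ALONG THE TOWER**: for a level family of bond transporters each `ε`-close to the identity,
`‖Q′_n(R)λ − Q′_n(1)λ‖_∞ ≤ ((1+ε)^{d(L−1)·n} − 1)·‖λ‖_∞` — telescoping `Q′_{n+1}(R) − Q′_{n+1}(1) = [Q′_n(R) − Q′_n(1)]Q′(R_n) + Q′_n(1)[Q′(R_n) − Q′(1)]`,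
the factors bounded by §1 and `norm_QprimeTower_id_le`. [cite: Balaban1985BackgroundPropagators, (3.19) p.393, p.403, (3.79)–(3.81) p.406] -/
theorem norm_QprimeTower_sub_id_le (Rlev : (n : ℕ) → Bond d (towerP L m (n + 1)) → V →ₗ[ℂ] V) {ε : ℝ} (hε : 0 ≤ ε)
    (hR : ∀ n b v, ‖Rlev n b v - v‖ ≤ ε * ‖v‖) :
    ∀ (n : ℕ) (l : TSite d (towerP L m n) → V),
      ‖QprimeTower L m Rlev n l - QprimeTower L m (fun _ _ => (LinearMap.id : V →ₗ[ℂ] V)) n l‖ ≤ (((1 + ε) ^ (d * (L - 1))) ^ n - 1) * ‖l‖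
  | 0, l => by simp
  | n + 1, l => by
    have hr1 : (1 : ℝ) ≤ (1 + ε) ^ (d * (L - 1)) := one_le_pow₀ (by linarith)
    have hrn : (0 : ℝ) ≤ ((1 + ε) ^ (d * (L - 1))) ^ n - 1 := sub_nonneg.2 (one_le_pow₀ hr1)
    show ‖QprimeTower L m Rlev n (QprimeLin L (towerP L m n) (Rlev n) l) -
        QprimeTower L m (fun _ _ => (LinearMap.id : V →ₗ[ℂ] V)) n
          (QprimeLin L (towerP L m n) (fun _ : Bond d (fineP L (towerP L m n)) => (LinearMap.id : V →ₗ[ℂ] V)) l)‖ ≤ _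
    set x := QprimeLin L (towerP L m n) (Rlev n) l with hx
    set y := QprimeLin L (towerP L m n) (fun _ : Bond d (fineP L (towerP L m n)) => (LinearMap.id : V →ₗ[ℂ] V)) l with hy
    have hsplit : QprimeTower L m Rlev n x - QprimeTower L m (fun _ _ => (LinearMap.id : V →ₗ[ℂ] V)) n y =
        (QprimeTower L m Rlev n x - QprimeTower L m (fun _ _ => (LinearMap.id : V →ₗ[ℂ] V)) n x) +
          QprimeTower L m (fun _ _ => (LinearMap.id : V →ₗ[ℂ] V)) n (x - y) := by
      rw [map_sub]; abel
    have h1 := norm_QprimeTower_sub_id_le Rlev hε hR n x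
    have hxn : ‖x‖ ≤ (1 + ε) ^ (d * (L - 1)) * ‖l‖ := norm_QprimeLin_le L (towerP L m n) (Rlev n) hε (hR n) l
    have h2 := norm_QprimeTower_id_le L m n (x - y)
    have hxy : ‖x - y‖ ≤ ((1 + ε) ^ (d * (L - 1)) - 1) * ‖l‖ := norm_QprimeLin_sub_flat_le L (towerP L m n) (Rlev n) hε (hR n) l
    calc ‖QprimeTower L m Rlev n x - QprimeTower L m (fun _ _ => (LinearMap.id : V →ₗ[ℂ] V)) n y‖
        ≤ ‖QprimeTower L m Rlev n x - QprimeTower L m (fun _ _ => (LinearMap.id : V →ₗ[ℂ] V)) n x‖ +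
            ‖QprimeTower L m (fun _ _ => (LinearMap.id : V →ₗ[ℂ] V)) n (x - y)‖ := by rw [hsplit]; exact norm_add_le _ _
      _ ≤ (((1 + ε) ^ (d * (L - 1))) ^ n - 1) * ((1 + ε) ^ (d * (L - 1)) * ‖l‖) + ((1 + ε) ^ (d * (L - 1)) - 1) * ‖l‖ :=
          add_le_add (h1.trans (mul_le_mul_of_nonneg_left hxn hrn)) (h2.trans hxy)
      _ = (((1 + ε) ^ (d * (L - 1))) ^ (n + 1) - 1) * ‖l‖ := by ring

end TowerPrime

section TowerQ

variable {𝔸 : Type*} [NormedRing 𝔸] [NormedAlgebra ℂ 𝔸] [CompleteSpace 𝔸] [NormOneClass 𝔸]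
  (m : Fin d → ℕ) [∀ i, NeZero (m i)] (hL : 1 ≤ L) (k : ℕ) (U : Bond d (towerP L m k) → 𝔸ˣ)
  (α : ℕ → ℝ) (hα1 : ∀ j, α j ≤ 1 / 64)
  (hU1 : ∀ (j : ℕ) (x : B7Prop1Explicit.Site d) (κ : Fin d), perCfg (towerP L m (j + 1)) (UlevOf L m k U j) x κ ∈ U1 𝔸)
  (hreg : ∀ (j : ℕ) (y : TSite d (towerP L m j)) (κ : Fin d) (r : Fin d → Fin L),
    ‖((Wcx L (perCfg (towerP L m (j + 1)) (UlevOf L m k U j)) (cornerSite L y) κ (boxVec L r) : 𝔸ˣ) : 𝔸) - 1‖ ≤ α j)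
  (hα2 : ∀ j, 50 * (d + 1) * α j ≤ 1) {εU : ℝ} (hεU : 0 ≤ εU) (hUε : ∀ (j : ℕ) (b : Bond d (towerP L m (j + 1))), ‖(UlevOf L m k U j b : 𝔸) - 1‖ ≤ εU)

include hL in
/-- **`‖(Q_n(1)A)(c)‖ ≤ sup‖A‖` along the flat tower** (the inhabited flat data of `B9Eq315QTowerFlat`, profile `α := 0`: each factor is an exact
average, (126) with `α = 0`). [cite: Balaban1985Averaging, (126) p.36; Balaban1985BackgroundPropagators, (3.15) p.393] -/
theorem norm_Qtower_flat_apply_le : ∀ (n : ℕ) (A : Bond d (towerP L m n) → 𝔸) {a : ℝ}, 0 ≤ a → (∀ b, ‖A b‖ ≤ a) → ∀ c : Bond d m,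
    ‖Qtower L m hL (UlevOf L m k (fun _ : Bond d (towerP L m k) => (1 : 𝔸ˣ))) (fun _ => 0) (fun _ => by norm_num)
      (perCfg_UlevOf_one_mem_U1 L m k) (norm_Wcx_UlevOf_one_sub_one_le L m k (fun _ => 0) (fun _ => le_rfl)) n A c‖ ≤ a
  | 0, A, a, _, hA, c => hA c
  | n + 1, A, a, ha, hA, c => by
    show ‖Qtower L m hL (UlevOf L m k (fun _ : Bond d (towerP L m k) => (1 : 𝔸ˣ))) (fun _ => 0) (fun _ => by norm_num)
        (perCfg_UlevOf_one_mem_U1 L m k) (norm_Wcx_UlevOf_one_sub_one_le L m k (fun _ => 0) (fun _ => le_rfl)) n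
        (QtorusLin L (towerP L m n) hL (UlevOf L m k (fun _ : Bond d (towerP L m k) => (1 : 𝔸ˣ)) n) (by norm_num)
          (perCfg_UlevOf_one_mem_U1 L m k n) (norm_Wcx_UlevOf_one_sub_one_le L m k (fun _ => 0) (fun _ => le_rfl) n) A) c‖ ≤ a
    refine norm_Qtower_flat_apply_le n _ ha (fun b => ?_) c
    exact (norm_QtorusLin_apply_le L (towerP L m n) hL _ (by norm_num) (perCfg_UlevOf_one_mem_U1 L m k n)
      (norm_Wcx_UlevOf_one_sub_one_le L m k (fun _ => 0) (fun _ => le_rfl) n) A ha hA b).trans (le_of_eq (by ring))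

include hα2 hεU hUε in
/-- **`Q_n(U)` AGAINST `Q_n(1)` ALONG THE TOWER, per coarse bond**: `‖(Q_n(U)A)(c) − (Q_n(1)A)(c)‖ ≤ (2^n − 1)·102(d+1)²L·ε̄·sup‖A‖` for a background
whose level averages `Ū^j` are `ε̄`-small (`‖Ū^j(b) − 1‖ ≤ ε̄`, DISPLAYED — [Balaban1985Averaging] Prop. 2) and block-regular in the regime
`50(d+1)α_j ≤ 1` — telescoping: `Q_{n+1}(U) − Q_{n+1}(1) = [Q_n(U) − Q_n(1)]Q(Ū^n) + Q_n(1)[Q(Ū^n) − Q(1)]`, with NE9 leaf-04's one-step modulus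
`norm_QtorusLin_sub_flat_le`, §1's `norm_QtorusLin_apply_le` (factor `≤ 2`) and `norm_Qtower_flat_apply_le`.
[cite: Balaban1985BackgroundPropagators, (3.15) p.393, (3.78)–(3.79) p.406; Balaban1985Averaging, (124)–(127) pp.36–37, Prop. 2 (52)–(54) p.26] -/
theorem norm_Qtower_sub_flat_apply_le : ∀ (n : ℕ) (A : Bond d (towerP L m n) → 𝔸) {a : ℝ}, 0 ≤ a → (∀ b, ‖A b‖ ≤ a) → ∀ c : Bond d m,
    ‖Qtower L m hL (UlevOf L m k U) α hα1 hU1 hreg n A c -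
      Qtower L m hL (UlevOf L m k (fun _ : Bond d (towerP L m k) => (1 : 𝔸ˣ))) (fun _ => 0) (fun _ => by norm_num)
        (perCfg_UlevOf_one_mem_U1 L m k) (norm_Wcx_UlevOf_one_sub_one_le L m k (fun _ => 0) (fun _ => le_rfl)) n A c‖ ≤
      (2 ^ n - 1) * (102 * (d + 1) ^ 2 * L * εU) * a
  | 0, A, a, _, _, c => by simp
  | n + 1, A, a, ha, hA, c => by
    have hθ : 0 ≤ 102 * (d + 1) ^ 2 * L * εU := by positivity
    have h2n : (0 : ℝ) ≤ 2 ^ n - 1 := sub_nonneg.2 (one_le_pow₀ (by norm_num))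
    -- the generic telescoping step: `x` = the level-`n` image at `U`, `y` = at the flat background
    have key : ∀ x y : Bond d (towerP L m n) → 𝔸, (∀ b, ‖x b‖ ≤ 2 * a) → (∀ b, ‖x b - y b‖ ≤ 102 * (d + 1) ^ 2 * L * εU * a) →
        ‖Qtower L m hL (UlevOf L m k U) α hα1 hU1 hreg n x c -
          Qtower L m hL (UlevOf L m k (fun _ : Bond d (towerP L m k) => (1 : 𝔸ˣ))) (fun _ => 0) (fun _ => by norm_num)
            (perCfg_UlevOf_one_mem_U1 L m k) (norm_Wcx_UlevOf_one_sub_one_le L m k (fun _ => 0) (fun _ => le_rfl)) n y c‖ ≤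
          (2 ^ (n + 1) - 1) * (102 * (d + 1) ^ 2 * L * εU) * a := by
      intro x y hxb hxyb
      have hsplit : Qtower L m hL (UlevOf L m k U) α hα1 hU1 hreg n x c -
          Qtower L m hL (UlevOf L m k (fun _ : Bond d (towerP L m k) => (1 : 𝔸ˣ))) (fun _ => 0) (fun _ => by norm_num)
            (perCfg_UlevOf_one_mem_U1 L m k) (norm_Wcx_UlevOf_one_sub_one_le L m k (fun _ => 0) (fun _ => le_rfl)) n y c =
          (Qtower L m hL (UlevOf L m k U) α hα1 hU1 hreg n x c -
            Qtower L m hL (UlevOf L m k (fun _ : Bond d (towerP L m k) => (1 : 𝔸ˣ))) (fun _ => 0) (fun _ => by norm_num)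
              (perCfg_UlevOf_one_mem_U1 L m k) (norm_Wcx_UlevOf_one_sub_one_le L m k (fun _ => 0) (fun _ => le_rfl)) n x c) +
          Qtower L m hL (UlevOf L m k (fun _ : Bond d (towerP L m k) => (1 : 𝔸ˣ))) (fun _ => 0) (fun _ => by norm_num)
            (perCfg_UlevOf_one_mem_U1 L m k) (norm_Wcx_UlevOf_one_sub_one_le L m k (fun _ => 0) (fun _ => le_rfl)) n (x - y) c := by
        rw [map_sub, Pi.sub_apply]; abel
      have h1 := norm_Qtower_sub_flat_apply_le n x (by positivity : (0 : ℝ) ≤ 2 * a) hxb c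
      have h2 := norm_Qtower_flat_apply_le L m hL k n (x - y) (by positivity : (0 : ℝ) ≤ 102 * (d + 1) ^ 2 * L * εU * a)
        (fun b => by rw [Pi.sub_apply]; exact hxyb b) c
      calc _ ≤ ‖Qtower L m hL (UlevOf L m k U) α hα1 hU1 hreg n x c -
            Qtower L m hL (UlevOf L m k (fun _ : Bond d (towerP L m k) => (1 : 𝔸ˣ))) (fun _ => 0) (fun _ => by norm_num)
              (perCfg_UlevOf_one_mem_U1 L m k) (norm_Wcx_UlevOf_one_sub_one_le L m k (fun _ => 0) (fun _ => le_rfl)) n x c‖ +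
            ‖Qtower L m hL (UlevOf L m k (fun _ : Bond d (towerP L m k) => (1 : 𝔸ˣ))) (fun _ => 0) (fun _ => by norm_num)
              (perCfg_UlevOf_one_mem_U1 L m k) (norm_Wcx_UlevOf_one_sub_one_le L m k (fun _ => 0) (fun _ => le_rfl)) n (x - y) c‖ := by
            rw [hsplit]; exact norm_add_le _ _
        _ ≤ (2 ^ n - 1) * (102 * (d + 1) ^ 2 * L * εU) * (2 * a) + 102 * (d + 1) ^ 2 * L * εU * a := add_le_add h1 h2
        _ = (2 ^ (n + 1) - 1) * (102 * (d + 1) ^ 2 * L * εU) * a := by ring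
    -- the flat factor at level `n` IS the one-step flat averaging (its background is `1` by `UlevOf_one`)
    have hy1 : ∀ b, QtorusLin L (towerP L m n) hL (UlevOf L m k (fun _ : Bond d (towerP L m k) => (1 : 𝔸ˣ)) n) (by norm_num)
        (perCfg_UlevOf_one_mem_U1 L m k n) (norm_Wcx_UlevOf_one_sub_one_le L m k (fun _ => 0) (fun _ => le_rfl) n) A b =
        QtorusLin L (towerP L m n) hL (fun _ : Bond d (fineP L (towerP L m n)) => (1 : 𝔸ˣ)) (show (0 : ℝ) ≤ 1 / 64 by norm_num)
        (B5Eq172FlatCoercivity.hU1_one L (towerP L m n)) (B5Eq172FlatCoercivity.hreg_one L (towerP L m n)) A b :=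
      QtorusLin_apply_eq_of_eq L (towerP L m n) hL _ _ _ _ (UlevOf_one L m k n) _ _ _ A
    refine key _ _ (fun b => ?_) (fun b => ?_)
    · have h : ‖QtorusLin L (towerP L m n) hL (UlevOf L m k U n) (hα1 n) (hU1 n) (hreg n) A b‖ ≤ (1 + 50 * (d + 1) * α n) * a :=
        norm_QtorusLin_apply_le L (towerP L m n) hL _ _ _ _ A ha hA b
      have hα0 : 0 ≤ α n := (norm_nonneg _).trans (hreg n b.1 b.2 fun _ => 0)
      have h2 : (1 + 50 * (d + 1) * α n) * a ≤ 2 * a := mul_le_mul_of_nonneg_right (by linarith [hα2 n]) ha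
      exact h.trans h2
    · have e := congrArg (fun t : 𝔸 => ‖QtorusLin L (towerP L m n) hL (UlevOf L m k U n) (hα1 n) (hU1 n) (hreg n) A b - t‖) (hy1 b)
      have h : ‖QtorusLin L (towerP L m n) hL (UlevOf L m k U n) (hα1 n) (hU1 n) (hreg n) A b -
          QtorusLin L (towerP L m n) hL (fun _ : Bond d (fineP L (towerP L m n)) => (1 : 𝔸ˣ)) (show (0 : ℝ) ≤ 1 / 64 by norm_num)
            (B5Eq172FlatCoercivity.hU1_one L (towerP L m n)) (B5Eq172FlatCoercivity.hreg_one L (towerP L m n)) A b‖ ≤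
          102 * (d + 1) ^ 2 * L * εU * a :=
        norm_QtorusLin_sub_flat_le L (towerP L m n) hL _ _ _ _ (show (0 : ℝ) ≤ 1 / 64 by norm_num)
          (B5Eq172FlatCoercivity.hU1_one L (towerP L m n)) (B5Eq172FlatCoercivity.hreg_one L (towerP L m n)) hεU (fun b' => hUε n b') A hA b
      exact e.trans_le h

end TowerQ

/-! ## §3 The readings at the tower letters of `B9Eq326OperatorTower` -/

section Readings

variable {𝔸 : Type*} [NormedRing 𝔸] [NormedAlgebra ℂ 𝔸] [CompleteSpace 𝔸] [NormOneClass 𝔸]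
  (m : Fin d → ℕ) [∀ i, NeZero (m i)] (n : ℕ) (hL : 1 ≤ L)
  {W : Type*} [NormedAddCommGroup W] [InnerProductSpace ℂ W] (φ : W ≃ₗ[ℂ] 𝔸) {Mφ Mφ' : ℝ} (hMφ : 0 ≤ Mφ) (hMφ' : 0 ≤ Mφ')
  (hφ : ∀ w, ‖φ w‖ ≤ Mφ * ‖w‖) (hφ' : ∀ X, ‖φ.symm X‖ ≤ Mφ' * ‖X‖) {c₀ c₁ : ℝ} [Fact (0 < c₀)] [Fact (0 < c₁)]
  (U : Bond d (towerP L m (n + 1)) → 𝔸ˣ) (α : ℕ → ℝ) (hα1 : ∀ j, α j ≤ 1 / 64)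
  (hU1 : ∀ (j : ℕ) (x : B7Prop1Explicit.Site d) (κ : Fin d), perCfg (towerP L m (j + 1)) (UlevOf L m (n + 1) U j) x κ ∈ U1 𝔸)
  (hreg : ∀ (j : ℕ) (y : TSite d (towerP L m j)) (κ : Fin d) (r : Fin d → Fin L),
    ‖((Wcx L (perCfg (towerP L m (j + 1)) (UlevOf L m (n + 1) U j)) (cornerSite L y) κ (boxVec L r) : 𝔸ˣ) : 𝔸) - 1‖ ≤ α j)
  (hα2 : ∀ j, 50 * (d + 1) * α j ≤ 1) {εU : ℝ} (hεU : 0 ≤ εU)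
  (hUε : ∀ (j : ℕ) (b : Bond d (towerP L m (j + 1))), ‖(UlevOf L m (n + 1) U j b : 𝔸) - 1‖ ≤ εU)
  (hUb : ∀ (j : ℕ) (b : Bond d (towerP L m (j + 1))), UlevOf L m (n + 1) U j b ∈ U1 𝔸)

include hφ hφ' hMφ hMφ' hεU hUε hUb in
/-- **THE TOWER LETTER `ρ′_k` PRODUCED**: `‖Q′_k(U)λ − Q′_k(1)λ‖_∞ ≤ ((1 + 2M_φM_φ′ε̄)^{d(L−1)(n+1)} − 1)·(√c₀)⁻¹·‖λ‖_{L²}` — the display `hQ'` of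
`B9Thm311SmallFieldCoercivityTower.exists_coercive_principalk_of_small_field` ∕ `laplaceAk_pos_of_small_field`, modulo the DISPLAYED smallness and
unit-boundedness of the level averages `Ū^j` ([Balaban1985Averaging] Prop. 2): the transporters `R(Ū^j(b))` read on the fibre are `2M_φM_φ′ε̄`-close to
the identity (`norm_adTransportW_sub_le`), §2, and `‖λ‖_∞ ≤ (√c₀)⁻¹‖λ‖_{L²}`. [cite: Balaban1985BackgroundPropagators, (3.19) p.393, (3.79)–(3.81) p.406; Balaban1985Averaging, Prop. 2 (52)–(54) p.26] -/
theorem norm_QprimeTowerW_sub_flat_le (l : SiteL2K ℂ d (towerP L m (n + 1)) c₀ W) :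
    ‖QprimeTowerW L m n φ U (c₀ := c₀) l - QprimeTowerW L m n φ (fun _ : Bond d (towerP L m (n + 1)) => (1 : 𝔸ˣ)) (c₀ := c₀) l‖ ≤
      (((1 + 2 * Mφ * Mφ' * εU) ^ (d * (L - 1))) ^ (n + 1) - 1) * ((Real.sqrt c₀)⁻¹ * ‖l‖) := by
  have hε : 0 ≤ 2 * Mφ * Mφ' * εU := by positivity
  have hR : ∀ (j : ℕ) (b : Bond d (towerP L m (j + 1))) (v : W), ‖adTransportW φ (UlevOf L m (n + 1) U j) b v - v‖ ≤ 2 * Mφ * Mφ' * εU * ‖v‖ :=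
    fun j b v => norm_adTransportW_sub_le φ hφ hφ' hMφ' _ b (hUb j b) (hUε j b) v
  have hflat : (fun j => adTransportW φ (UlevOf L m (n + 1) (fun _ : Bond d (towerP L m (n + 1)) => (1 : 𝔸ˣ)) j)) =
      fun _ _ => (LinearMap.id : W →ₗ[ℂ] W) := by
    funext j b; rw [UlevOf_one, adTransportW_one]
  have h := norm_QprimeTower_sub_id_le L m (fun j => adTransportW φ (UlevOf L m (n + 1) U j)) hε hR (n + 1)
    (WL2.linearEquiv ℂ ℂ (fun _ : TSite d (towerP L m (n + 1)) => c₀) l)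
  have hr : (0 : ℝ) ≤ ((1 + 2 * Mφ * Mφ' * εU) ^ (d * (L - 1))) ^ (n + 1) - 1 := sub_nonneg.2 (one_le_pow₀ (one_le_pow₀ (by linarith)))
  rw [QprimeTowerW, QprimeTowerW, hflat, LinearMap.comp_apply, LinearMap.comp_apply, LinearEquiv.coe_toLinearMap]
  exact h.trans (mul_le_mul_of_nonneg_left (pi_norm_le_WL2_norm L (towerP L m n) l) hr)

include hφ hφ' hMφ hMφ' hα2 hεU hUε in
/-- **THE TOWER LETTER `δ_{Q,k}` PRODUCED**: `‖Q_k(U)f − Q_k(1)f‖_{L²} ≤ M_φ′·M_φ·√(c₁|𝔅(T_m)|∕c₀)·(2^{n+1} − 1)·102(d+1)²L·ε̄·‖f‖_{L²}` against the flat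
tower with `B9Eq315QTowerFlat`'s inhabited data (profile `α := 0`) — the display `hQ` of `B9Thm311SmallFieldCoercivityTower`, modulo the DISPLAYED
smallness of the level averages and the regime `50(d+1)α_j ≤ 1`: §2 at the `𝔸`-valued function `b ↦ φ(f(b))` (sup `≤ M_φ‖f‖∕√c₀`), read back along
`φ⁻¹` and summed with the coarse weight (NE9 leaf-04's one-step road one storey up).
[cite: Balaban1985BackgroundPropagators, (3.15)–(3.16) p.393, (3.78)–(3.79) p.406; Balaban1985Averaging, (124)–(127) pp.36–37, Prop. 2 (52)–(54) p.26] -/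
theorem norm_QkW_sub_flat_le (f : BondL2K ℂ d (towerP L m (n + 1)) c₀ W) :
    ‖QkW L m n φ U hL α hα1 hU1 hreg (c₀ := c₀) (c₁ := c₁) f -
        QkW L m n φ (fun _ : Bond d (towerP L m (n + 1)) => (1 : 𝔸ˣ)) hL (fun _ => 0) (fun _ => by norm_num)
          (perCfg_UlevOf_one_mem_U1 L m (n + 1)) (norm_Wcx_UlevOf_one_sub_one_le L m (n + 1) (fun _ => 0) (fun _ => le_rfl)) (c₀ := c₀) (c₁ := c₁) f‖ ≤
      Mφ' * Mφ * Real.sqrt (c₁ * Fintype.card (Bond d m) / c₀) * ((2 ^ (n + 1) - 1) * (102 * (d + 1) ^ 2 * L * εU)) * ‖f‖ := by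
  have hc₀ : 0 < c₀ := Fact.out
  set g : Bond d (towerP L m (n + 1)) → 𝔸 := fun b => φ (WL2.equiv ℂ _ W f b) with hg
  set a : ℝ := Mφ * (‖f‖ / Real.sqrt c₀) with ha_def
  have ha0 : 0 ≤ a := mul_nonneg hMφ (div_nonneg (norm_nonneg f) (Real.sqrt_nonneg _))
  have ha : ∀ b, ‖g b‖ ≤ a := fun b => (hφ _).trans (mul_le_mul_of_nonneg_left (norm_apply_le_of_WL2 f b) hMφ)
  have h2n : (0 : ℝ) ≤ 2 ^ (n + 1) - 1 := sub_nonneg.2 (one_le_pow₀ (by norm_num))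
  have hpt : ∀ c : Bond d m,
      ‖WL2.equiv ℂ _ W (QkW L m n φ U hL α hα1 hU1 hreg (c₀ := c₀) (c₁ := c₁) f -
          QkW L m n φ (fun _ : Bond d (towerP L m (n + 1)) => (1 : 𝔸ˣ)) hL (fun _ => 0) (fun _ => by norm_num)
            (perCfg_UlevOf_one_mem_U1 L m (n + 1)) (norm_Wcx_UlevOf_one_sub_one_le L m (n + 1) (fun _ => 0) (fun _ => le_rfl))
            (c₀ := c₀) (c₁ := c₁) f) c‖ ≤ Mφ' * ((2 ^ (n + 1) - 1) * (102 * (d + 1) ^ 2 * L * εU) * a) := by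
    intro c
    rw [WL2.equiv_sub, Pi.sub_apply]
    show ‖φ.symm (QkOfU L m hL (n + 1) U α hα1 hU1 hreg g c) -
        φ.symm (QkOfU L m hL (n + 1) (fun _ : Bond d (towerP L m (n + 1)) => (1 : 𝔸ˣ)) (fun _ => 0) (fun _ => by norm_num)
          (perCfg_UlevOf_one_mem_U1 L m (n + 1)) (norm_Wcx_UlevOf_one_sub_one_le L m (n + 1) (fun _ => 0) (fun _ => le_rfl)) g c)‖ ≤ _
    rw [← map_sub]
    exact (hφ' _).trans (mul_le_mul_of_nonneg_left
      (norm_Qtower_sub_flat_apply_le L m hL (n + 1) U α hα1 hU1 hreg hα2 hεU hUε (n + 1) g ha0 ha c) hMφ')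
  have hB0 : 0 ≤ Mφ' * ((2 ^ (n + 1) - 1) * (102 * (d + 1) ^ 2 * L * εU) * a) := by positivity
  refine (norm_WL2_le_of_pointwise _ hB0 hpt).trans (le_of_eq ?_)
  rw [ha_def, Real.sqrt_div' _ hc₀.le]
  ring

end Readings

end Literature.MathematicalPhysics.QuantumFieldTheory.Balaban1983to89.B9Eq315QTowerLipschitz

end
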